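import Summits.QuantumFields.BalabanUV.T4Continuum.Support.B13DomainGeometryTR
import Literature.MathematicalPhysics.QuantumFieldTheory.Balaban1983to89.T4HistoryLipschitzCubeGeometry

/-!
# NE5 ∕ NE9 ∕ node U3, row O1-a follower — `B13CarriersCubeChart`: row NE9's cube chart `T4HistoryLipschitzCubeGeometry.CubeChart`
# INSTANTIATED on the two-run carriers of record `B13Carriers.TwoRuns.carriers` (re-using route P2's sigma cubes ∕ adjacency ∕
# footprints OF RECORD, `B13DomainGeometryTR`), so that NE9's generic END and NE5's END faces live on ONE `Carriers`

Cell `pub-balaban`, T⁴ sub-cell, NE5 formalisation swarm seat `b2b-balaban-t4-ne5-formalise-leaf-05` (holder of row O1-a CARRIERS;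
instance of record `Support/B13Carriers.lean` p207668 ADOPTED, journal l.5870; INTENT for this follower l.6270).  Summits-side NEW WORK
under the LEAN PLACEMENT RULE: finite combinatorics only — no analytic object of Bałaban's construction occurs, no estimate of the
manuscripts is used or asserted; nothing of `B13Carriers` ∕ `B13DomainGeometryTR` ∕ `T4HistoryLipschitzCubeGeometry` is edited
(imported BY NAME).  HONEST FRAMING (T4-DAG p. 1): rung (B)+1 on a FIXED finite torus T⁴ — NOT infinite volume, NOT a mass gap, NOT
the Clay problem; neither NE5 nor NE9 is proved here; spine 0∕9.  HONEST DEPENDENCY (cell line, verbatim): continuum YM on T⁴ ⇐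
BetaPertH ∧ nine spine estimates (0/9 proved); BetaPertH ⇐ (D1) ∧ (D4) ∧ CAP+tail; G-an2-4 gates asym, D1 and NE2/3/4.

WHY.  Node U3's three-bracket bookkeeping `T4OutputRate.u3_threeBrackets` takes `NE9 EA W κ Λ`, `LipBackground EA W κ CU` and
`NE5 EA EB W κ θ C₅` on ONE `Carriers`.  NE5's END faces and route P2's adapter (`B13DomainGeometryTR`) live on the carriers of
record `R.carriers`; NE9's generic END `T4HistoryLipschitzSegment.cubeChart_ne9_and_fadingMemory_of_domainDecay (Γ : CubeChart C α adj D)`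
(lineage t4-ne9-p2) takes a CUBE CHART of the carriers — which the NE9 lineage built on its own multi-scale carriers
`NE9MultiScaleChart.msCarriers` (lattice-edge size `linSize`), not on `R.carriers` (tree length `torusTreeLen`).  This file supplies
the chart ON `R.carriers`, so NE9's END can be run on the same `C` as NE5's.

WHAT IS PROVED (kernel-checked), for every `R : B13Carriers.TwoRuns G`: `Std.Symm (SAdj R)` (P2's fibrewise wall adjacency of sigma
cubes); `card_filter_sAdj_le` — every sigma cube has at most `2·4 = 8` `SAdj`-neighbours in any family (the tree's `tdegreeLE`,
[Balaban1987RG1] p. 257 cube walls); `region X` = all cubes of `π_{scale X}` embedded, containing the footprint; and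
**`cubeChart R : CubeChart R.carriers (SCube R) (SAdj R) 8`** with `cubes := footprint` (P2's), `region`, `deg := card_filter_sAdj_le`,
`d_le` from `TwoRuns.d_le_card_sub_one` (the upper half of [Balaban1988RG2Cluster] (2.30) p. 18 for `torusTreeLen`, BY NAME).
0 sorry; axioms ⊆ {propext, Classical.choice, Quot.sound}.
-/

noncomputable section

namespace Summit.QuantumFields.BalabanUV.T4Continuum.B13CarriersCubeChart

open Literature.MathematicalPhysics.QuantumFieldTheory.Balaban1983to89
open Literature.MathematicalPhysics.QuantumFieldTheory.Balaban1983to89.TreeLengthTorus (TPt TAdj TDom tnbr mem_tnbr tdegreeLE)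
open Literature.MathematicalPhysics.QuantumFieldTheory.Balaban1983to89.T4HistoryLipschitzCubeGeometry (CubeChart)
open Summit.QuantumFields.BalabanUV.T4Continuum.B13Carriers (TwoRuns)
open Summit.QuantumFields.BalabanUV.T4Continuum.B13DomainGeometryTR (SCube SAdj sAdj_mk_iff fst_eq_of_sAdj embed embed_apply
  footprint footprint_nonempty card_footprint fst_eq_of_mem_footprint)

variable {G : Type} [GaugeGroup G] (R : TwoRuns G)

/-- P2's fibrewise wall adjacency of sigma cubes is symmetric, as an `Std.Symm` instance (what `CubeChart`'s consumers ask).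
[folklore] -/
instance instSymmSAdj : Std.Symm (SAdj R) := ⟨fun _ _ h => h.symm⟩

variable {R}

/-- Every wall-neighbour (torus sense) of a cube of `π_j` lies in the tree's neighbour list `tnbr`, which has at most `2·4`
members (`TreeLengthTorus.tdegreeLE`). [folklore] -/
theorem card_filter_tadj_le {N : ℕ} [NeZero N] (a : TPt 4 N) (Q : Finset (TPt 4 N)) : (Q.filter (TAdj a)).card ≤ 8 := by
  classical
  have hsub : Q.filter (TAdj a) ⊆ tnbr a := fun b hb => mem_tnbr.2 (Finset.mem_filter.1 hb).2
  have h := tdegreeLE 4 N a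
  exact (Finset.card_le_card hsub).trans h

/-- **DEGREE ≤ 8 OF THE SIGMA-CUBE ADJACENCY**: the `SAdj`-neighbours of `⟨j, a⟩` in any family are embedded torus wall-neighbours of
`a` in `π_j` ([Balaban1987RG1] p. 257: a cube of the four-torus has `2·4` walls). [folklore] -/
theorem card_filter_sAdj_le (x : SCube R) (Q : Finset (SCube R)) : (Q.filter (SAdj R x)).card ≤ 8 := by
  classical
  obtain ⟨j, a⟩ := x
  have hsub : Q.filter (SAdj R ⟨j, a⟩) ⊆ (tnbr a).map (embed R j) := by
    intro y hy
    obtain ⟨-, hadj⟩ := Finset.mem_filter.1 hy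
    obtain ⟨j', b⟩ := y
    have hjj : j = j' := fst_eq_of_sAdj hadj
    subst hjj
    exact Finset.mem_map.2 ⟨b, mem_tnbr.2 (sAdj_mk_iff.1 hadj), rfl⟩
  calc (Q.filter (SAdj R ⟨j, a⟩)).card ≤ ((tnbr a).map (embed R j)).card := Finset.card_le_card hsub
    _ = (tnbr a).card := Finset.card_map _
    _ ≤ 2 * 4 := tdegreeLE 4 (R.cubesPerDir j) a

/-- THE REGION of a domain: all cubes of the torus `π_{scale X}`, embedded as sigma cubes. [folklore] -/
def region (X : R.carriers.Dom) : Finset (SCube R) := (Finset.univ : Finset (TPt 4 (R.cubesPerDir X.1))).map (embed R X.1)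

/-- The footprint lies in the region. [folklore] -/
theorem footprint_subset_region (X : R.carriers.Dom) : footprint X ⊆ region X :=
  Finset.map_subset_map.2 (Finset.subset_univ _)

/-- Membership in the region: exactly the sigma cubes of the domain's scale. [folklore] -/
theorem mem_region_iff {X : R.carriers.Dom} {c : SCube R} : c ∈ region X ↔ c.1 = X.1 := by
  constructor
  · intro h
    obtain ⟨q, -, rfl⟩ := Finset.mem_map.1 h
    rfl
  · intro h
    obtain ⟨i, q⟩ := c
    cases h
    exact Finset.mem_map.2 ⟨q, Finset.mem_univ _, rfl⟩

/-- The region has `#π_j = (cubes per direction)^4` members. [folklore] -/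
theorem card_region (X : R.carriers.Dom) : (region X).card = R.cubesPerDir X.1 ^ 4 := by
  rw [region, Finset.card_map, Finset.card_univ, Fintype.card_pi, Finset.prod_const, ZMod.card, Finset.card_univ,
    Fintype.card_fin]

variable (R) in
/-- **NE9's CUBE CHART ON THE CARRIERS OF RECORD**: cubes = P2's embedded footprints, region = the whole torus of the domain's scale,
adjacency = P2's `SAdj` with degree `8`, and `d ≤ #cubes` from the upper half of (2.30) for `torusTreeLen` (`TwoRuns.d_le_card_sub_one`).
NE9's generic END `T4HistoryLipschitzSegment.cubeChart_ne9_and_fadingMemory_of_domainDecay` applies to it verbatim, on the same `C`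
as NE5's END faces. [cite: Balaban1988RG2Cluster, (2.30) p.18 (upper half)] -/
def cubeChart : CubeChart R.carriers (SCube R) (SAdj R) 8 where
  cubes := footprint
  region := region
  cubes_sub := footprint_subset_region
  cubes_nonempty := footprint_nonempty
  deg := card_filter_sAdj_le
  d_le := fun X => by
    rw [card_footprint]
    have h := R.d_le_card_sub_one X
    linarith

/-- The cubes of `cubeChart` are P2's footprints (definitional). [folklore] -/
@[simp] theorem cubeChart_cubes (X : R.carriers.Dom) : (cubeChart R).cubes X = footprint X := rfl

/-- The region of `cubeChart` is `region` (definitional). [folklore] -/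
@[simp] theorem cubeChart_region (X : R.carriers.Dom) : (cubeChart R).region X = region X := rfl

/-- The footprint of every domain has at least one cube and at most the whole torus of its scale. [folklore] -/
theorem one_le_card_cubes_le (X : R.carriers.Dom) :
    1 ≤ ((cubeChart R).cubes X).card ∧ ((cubeChart R).cubes X).card ≤ R.cubesPerDir X.1 ^ 4 := by
  refine ⟨?_, ?_⟩
  · rw [cubeChart_cubes, card_footprint]
    exact R.one_le_card X
  · rw [← card_region X]
    exact Finset.card_le_card (footprint_subset_region X)

end Summit.QuantumFields.BalabanUV.T4Continuum.B13CarriersCubeChart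

end
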